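import Literature.Topology.FourManifolds.RealProjectiveSpaceCohomology
import Literature.Topology.FourManifolds.BordismFourUnorientedCount
import Literature.AlgebraicTopology.SingularHomology.SteenrodSquareOneBockstein
import HarnessLib

/-!
# `v₁⁴[ℝℙ⁴] = 1`: the second generator of `𝔑₄`, and the lower-bound half of `|𝔑₄| = 4`

R. Thom, *Quelques propriétés globales des variétés différentiables*, Comment. Math. Helv. 28
(1954), Thm. IV.12 and "Les générateurs pour les petites dimensions", pp. 79–80: "Pour `k = 4` …
le groupe `𝔑⁴` est isomorphe à `ℤ₂ + ℤ₂`"; the generators are represented by `PR(4)` (with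
`PR(2)²`) and `PC(2)` ("`PC(2)` est cobordant mod 2 au carré du plan projectif réel `PR(2)`"),
separated by the Stiefel–Whitney numbers `w₄ = χ mod 2` and `w₁⁴`; J. W. Milnor, J. D. Stasheff,
*Characteristic Classes* (1974), §4 p. 51 (Example: `w₁⁴[ℝℙ⁴] ≠ 0`, so `ℝℙ⁴` does not bound,
Thm. 4.9) and §11 p. 132 (Wu classes; by Wu's formula `v₁ = w₁`).

This file PROVES, from `H*(ℝℙ⁴; 𝔽₂) = {0, ωᵏ}` in degrees `k ≤ 3` with `ω⁴ ≠ 0`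
(`RealProjectiveSpaceCohomology.lean`), the Cartan formula for `Sq¹` and `Sq¹ = β`
(`SteenrodSquareOneBockstein.lean`), and the bordism invariant `v₁⁴[·] : 𝔑₄ → ℤ/2`
(`BordismWuNumbers.lean`):

* `steenrodSq_one_omegaPow_three : Sq¹ ω³ = ω⁴` (`Sq¹(ω ⌣ ω²) = ω² ⌣ ω² + ω ⌣ Sq¹ω²`,
  `Sq¹ω = ω²`, `Sq¹ω² = 0`);
* **`wuClass_one_realProjectiveSpace_four : v₁(ℝℙ⁴) = ω`** (the Wu class is characterised by
  `⟨v₁ ⌣ x, [ℝℙ⁴]₂⟩ = ⟨Sq¹ x, [ℝℙ⁴]₂⟩` on `H³ = {0, ω³}`);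
* **`wuNumberOnePowFour_realProjectiveSpace_four : v₁⁴[ℝℙ⁴] = 1`** (`⟨ω⁴, [ℝℙ⁴]₂⟩ ≠ 0`);
* in `𝔑₄`: `[ℝℙ⁴] ≠ 0`, `[ℝℙ⁴] ≠ [ℂℙ²]`, and `four_le_natCard_unorientedBordismClass_four`: the
  classes `0, [ℂℙ²], [ℝℙ⁴], [ℂℙ²] + [ℝℙ⁴]` are pairwise distinct (so `4 ≤ |𝔑₄|` when finite);
* **`natCard_unorientedBordismClass_four_of_injective`** — the target
  `Literature.Topology.FourManifolds.natCard_unorientedBordismClass_four` (`|𝔑₄| = 4`) now follows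
  from the SINGLE remaining hypothesis that Thom's invariant `(χ mod 2, v₁⁴) : 𝔑₄ → (ℤ/2)²` is
  injective (Thom's Thm. IV.10 at `k = 4`: a closed 4-manifold all of whose Stiefel–Whitney
  numbers vanish bounds — the Pontryagin–Thom computation, not in the tree).

No named facts.

## References

* R. Thom, *Quelques propriétés globales des variétés différentiables*, Comment. Math. Helv. 28
  (1954), 17–86: Thm. IV.3, IV.9, IV.10, IV.12, pp. 79–80. [ThomCMH1954]
* J. W. Milnor, J. D. Stasheff, *Characteristic Classes*, Ann. of Math. Studies 76 (1974), §4
  p. 51, Thm. 4.5, Thm. 4.9; §11 p. 132, Thm. 11.14. [MilnorStasheff1974]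
* A. Hatcher, *Algebraic Topology*, CUP 2002, Thm. 3.19, §4.L p. 489. [HatcherAT2002]
-/

noncomputable section

open scoped Manifold ContDiff
open CategoryTheory Set Function
open Literature.AlgebraicTopology.SingularHomology

namespace Literature.Topology.FourManifolds

namespace RealProjectiveSpace

/-! ### Low powers of `ω ∈ H¹(ℝℙ⁴; 𝔽₂)` in literal degrees -/

/-- `ω² = ω ⌣ ω`. [cite: HatcherAT2002, Thm. 3.19] -/
lemma omegaPow_four_two : omegaPow 4 2 = cupProduct (show 1 + 1 = 2 by rfl) (omega 4) (omega 4) :=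
  omegaPow_succ_eq_cupProduct 4 1

/-- `ω³ = ω ⌣ ω²`. [cite: HatcherAT2002, Thm. 3.19] -/
lemma omegaPow_four_three : omegaPow 4 3 = cupProduct (show 1 + 2 = 3 by rfl) (omega 4) (omegaPow 4 2) :=
  omegaPow_succ_eq_cupProduct 4 2

/-- `ω⁴ = ω ⌣ ω³`. [cite: HatcherAT2002, Thm. 3.19] -/
lemma omegaPow_four_four : omegaPow 4 4 = cupProduct (show 1 + 3 = 4 by rfl) (omega 4) (omegaPow 4 3) :=
  omegaPow_succ_eq_cupProduct 4 3

/-- `(ω ⌣ ω) ⌣ (ω ⌣ ω) = ω⁴` (associativity). [cite: HatcherAT2002, Thm. 3.19] -/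
lemma cupProduct_omega_sq_omega_sq :
    cupProduct (show 2 + 2 = 4 by rfl) (cupProduct (show 1 + 1 = 2 by rfl) (omega 4) (omega 4))
      (cupProduct (show 1 + 1 = 2 by rfl) (omega 4) (omega 4)) = omegaPow 4 4 := by
  rw [omegaPow_four_four, omegaPow_four_three, omegaPow_four_two]
  exact cupProduct_assoc (show 1 + 1 = 2 by rfl) (show 1 + 2 = 3 by rfl) (show 2 + 2 = 4 by rfl)
    (show 1 + 3 = 4 by rfl) (omega 4) (omega 4) _

/-! ### `Sq¹` on `H*(ℝℙ⁴; 𝔽₂)` -/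

/-- `Sq¹ ω = ω²`. [cite: HatcherAT2002, §4.L p. 489 (1) and Thm. 3.19] -/
theorem steenrodSq_one_omega : steenrodSq (RealProjectiveSpace 4) 1 1 (omega 4) = omegaPow 4 2 := by
  rw [steenrodSq_self, omegaPow_four_two]

/-- `Sq¹ ω² = 0`. [cite: HatcherAT2002, §4.L p. 489 (3),(6)] -/
theorem steenrodSq_one_omegaPow_two : steenrodSq (RealProjectiveSpace 4) 2 1 (omegaPow 4 2) = 0 := by
  rw [omegaPow_four_two]
  exact steenrodSq_one_cupProduct_self (omega 4)

/-- **`Sq¹ ω³ = ω⁴`** (Cartan formula for `Sq¹`: `Sq¹(ω ⌣ ω²) = ω² ⌣ ω² + ω ⌣ 0`).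
[cite: HatcherAT2002, §4.L p. 489 (3) and Thm. 3.19] -/
theorem steenrodSq_one_omegaPow_three : steenrodSq (RealProjectiveSpace 4) 3 1 (omegaPow 4 3) = omegaPow 4 4 := by
  rw [omegaPow_four_three, steenrodSq_one_cupProduct (show 1 + 2 = 3 by rfl) (omega 4) (omegaPow 4 2),
    steenrodSq_one_omega, steenrodSq_one_omegaPow_two, LinearMap.map_zero, add_zero, omegaPow_four_two]
  exact cupProduct_omega_sq_omega_sq

/-! ### The first Wu class of `ℝℙ⁴` -/

/-- **`v₁(ℝℙ⁴) = ω`**: on `H³(ℝℙ⁴; 𝔽₂) = {0, ω³}`, `⟨ω ⌣ ω³, [ℝℙ⁴]₂⟩ = ⟨ω⁴, [ℝℙ⁴]₂⟩ = ⟨Sq¹ ω³, [ℝℙ⁴]₂⟩`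
(Milnor–Stasheff 1974, §11 p. 132: the Wu class is characterised by `⟨v ⌣ x, μ⟩ = ⟨Sq x, μ⟩`; by
Wu's formula this is `w₁(ℝℙ⁴) = a`, loc. cit. Example p. 133 / Thm. 4.5). [cite: MilnorStasheff1974, §11 p. 132 and Thm. 4.5] -/
theorem wuClass_one_realProjectiveSpace_four : wuClass (RealProjectiveSpace 4) 4 1 = omega 4 := by
  symm
  refine eq_wuClass_of_forall (p := 3) (show 1 + 3 = 4 by rfl) fun x => ?_
  rcases eq_zero_or_eq_omegaPow 4 (by norm_num) (k := 3) (by norm_num) x with rfl | rfl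
  · simp only [map_zero, LinearMap.zero_apply]
  · change _ = kroneckerPairing (ZMod 2) (ZMod 2) (RealProjectiveSpace 4) 4
      (steenrodSq (RealProjectiveSpace 4) 3 1 (omegaPow 4 3)) _
    rw [steenrodSq_one_omegaPow_three, ← omegaPow_four_four]

/-- **`v₁⁴[ℝℙ⁴] = 1`** (Thom 1954, pp. 79–80: `PR(4)` represents a generator of `𝔑⁴ ≅ ℤ₂ + ℤ₂`
with `w₁⁴ ≠ 0`; Milnor–Stasheff 1974, §4 Example p. 51: `w₁⁴[ℝℙ⁴] ≠ 0`).
[cite: ThomCMH1954, Thm. IV.12 and pp. 79–80] [cite: MilnorStasheff1974, §4 p. 51] -/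
theorem wuNumberOnePowFour_realProjectiveSpace_four : wuNumberOnePowFour (RealProjectiveSpace 4) = 1 := by
  have hne : wuNumberOnePowFour (RealProjectiveSpace 4) ≠ 0 := by
    rw [wuNumberOnePowFour, wuClassOnePowFour, wuClass_one_realProjectiveSpace_four, cupProduct_omega_sq_omega_sq]
    exact kroneckerPairing_omegaPow_top_ne_zero 4 (by norm_num)
  revert hne
  generalize wuNumberOnePowFour (RealProjectiveSpace 4) = a
  intro hne
  fin_cases a
  · exact absurd rfl hne
  · rfl

end RealProjectiveSpace

/-! ### Consequences in `𝔑₄` -/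

/-- **`v₁⁴[[ℝℙ⁴]] = 1` in `𝔑₄`.** [cite: ThomCMH1954, Thm. IV.12 and pp. 79–80] -/
theorem UnorientedBordismClass.wuNumberOnePowFour_mk_realProjectiveSpace_four :
    UnorientedBordismClass.wuNumberOnePowFour
      (UnorientedBordismClass.mk (RealProjectiveSpace 4) : UnorientedBordismClass.{0} 4) = 1 := by
  rw [UnorientedBordismClass.wuNumberOnePowFour_mk']
  exact RealProjectiveSpace.wuNumberOnePowFour_realProjectiveSpace_four

/-- **`[ℝℙ⁴] ≠ 0` in `𝔑₄`**: `ℝℙ⁴` does not bound (its number `v₁⁴ = w₁⁴` is `1`; Thom 1954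
Thm. IV.3; Milnor–Stasheff 1974, §4 p. 51–52). [cite: ThomCMH1954, Thm. IV.3 and pp. 79–80] [cite: MilnorStasheff1974, §4 Thm. 4.9] -/
theorem unorientedBordismClass_mk_realProjectiveSpace_four_ne_zero :
    (UnorientedBordismClass.mk (RealProjectiveSpace 4) : UnorientedBordismClass.{0} 4) ≠ 0 := by
  intro h
  have h1 := UnorientedBordismClass.wuNumberOnePowFour_mk_realProjectiveSpace_four
  rw [h, UnorientedBordismClass.wuNumberOnePowFour_zero] at h1
  exact zero_ne_one h1

/-- **`[ℝℙ⁴] ≠ [ℂℙ²]` in `𝔑₄`** (`v₁⁴[ℂℙ²] = 0 ≠ 1 = v₁⁴[ℝℙ⁴]`): the two classes of Thom's list of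
generators are distinct. [cite: ThomCMH1954, Thm. IV.12 and pp. 79–80] -/
theorem unorientedBordismClass_mk_realProjectiveSpace_four_ne_mk_complexProjectivePlane :
    (UnorientedBordismClass.mk (RealProjectiveSpace 4) : UnorientedBordismClass.{0} 4) ≠
      UnorientedBordismClass.mk ComplexProjectivePlane := by
  intro h
  have h1 := UnorientedBordismClass.wuNumberOnePowFour_mk_realProjectiveSpace_four
  rw [h, UnorientedBordismClass.wuNumberOnePowFour_mk', wuNumberOnePowFour_complexProjectivePlane] at h1
  exact zero_ne_one h1

/-- **The lower-bound half of `|𝔑₄| = 4` is discharged: `|𝔑₄| = 4` follows from the injectivity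
of Thom's invariant `(χ mod 2, v₁⁴)` alone** (Thom 1954, Thm. IV.10/IV.12 at `k = 4` — the
Pontryagin–Thom computation, NOT proved in the tree). [cite: ThomCMH1954, Thm. IV.9, IV.10, IV.12] -/
theorem natCard_unorientedBordismClass_four_of_injective
    (hUB : Function.Injective (UnorientedBordismClass.thomInvariant : UnorientedBordismClass.{0} 4 → _)) :
    natCard_unorientedBordismClass_four :=
  natCard_unorientedBordismClass_four_of
    ⟨_, UnorientedBordismClass.wuNumberOnePowFour_mk_realProjectiveSpace_four⟩ hUB

/-- **Four pairwise distinct classes in `𝔑₄`**: `0`, `[ℂℙ²]`, `[ℝℙ⁴]`, `[ℂℙ²] + [ℝℙ⁴]` (Thom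
1954, pp. 79–80: `𝔑⁴ ≅ ℤ₂ + ℤ₂` with these representatives); hence `4 ≤ |𝔑₄|` whenever `𝔑₄` is
finite. [cite: ThomCMH1954, Thm. IV.12 and pp. 79–80] -/
theorem four_le_natCard_unorientedBordismClass_four [Finite (UnorientedBordismClass.{0} 4)] :
    4 ≤ Nat.card (UnorientedBordismClass.{0} 4) := by
  classical
  haveI := ClosedSingularManifold.bordismFacts_succ (Y := PUnit.{1}) (n := 3)
  letI : Fintype (UnorientedBordismClass.{0} 4) := Fintype.ofFinite _
  set b : UnorientedBordismClass.{0} 4 := UnorientedBordismClass.mk ComplexProjectivePlane with hbdef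
  set c : UnorientedBordismClass.{0} 4 := UnorientedBordismClass.mk (RealProjectiveSpace 4) with hcdef
  have hb0 : b ≠ 0 := unorientedBordismClass_mk_complexProjectivePlane_ne_zero_holds
  have hvb : UnorientedBordismClass.wuNumberOnePowFour b = 0 := by
    rw [hbdef, UnorientedBordismClass.wuNumberOnePowFour_mk']
    exact wuNumberOnePowFour_complexProjectivePlane
  have hvc : UnorientedBordismClass.wuNumberOnePowFour c = 1 :=
    UnorientedBordismClass.wuNumberOnePowFour_mk_realProjectiveSpace_four
  have hv0 : UnorientedBordismClass.wuNumberOnePowFour (0 : UnorientedBordismClass.{0} 4) = 0 :=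
    UnorientedBordismClass.wuNumberOnePowFour_zero
  have hvbc : UnorientedBordismClass.wuNumberOnePowFour (b + c) = 1 := by
    rw [UnorientedBordismClass.wuNumberOnePowFour_add, hvb, hvc, zero_add]
  have h01 : (0 : UnorientedBordismClass.{0} 4) ≠ b := fun h => hb0 h.symm
  have h02 : (0 : UnorientedBordismClass.{0} 4) ≠ c := fun h => by
    rw [← h, hv0] at hvc; exact zero_ne_one hvc
  have h03 : (0 : UnorientedBordismClass.{0} 4) ≠ b + c := fun h => by
    rw [← h, hv0] at hvbc; exact zero_ne_one hvbc
  have h12 : b ≠ c := fun h => by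
    rw [h, hvc] at hvb; exact one_ne_zero hvb
  have h13 : b ≠ b + c := fun h => by
    rw [← h, hvb] at hvbc; exact zero_ne_one hvbc
  have h23 : c ≠ b + c := fun h => by
    apply hb0
    have h' : b + c + c = c + c := by rw [← h]
    rwa [BordismClass.add_assoc, BordismClass.add_self_eq_zero, BordismClass.add_zero] at h'
  have hs : ({0, b, c, b + c} : Finset (UnorientedBordismClass.{0} 4)).card = 4 := by
    rw [Finset.card_insert_of_notMem (by simp [h01, h02, h03]),
      Finset.card_insert_of_notMem (by simp [h12, h13]),
      Finset.card_insert_of_notMem (by simp [h23]), Finset.card_singleton]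
  have hu := Finset.card_le_univ ({0, b, c, b + c} : Finset (UnorientedBordismClass.{0} 4))
  rw [hs] at hu
  rw [Nat.card_eq_fintype_card]
  exact hu

end Literature.Topology.FourManifolds
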